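import Summits.Ventures.DiscreteObjects.STD.OrderThreeFixedPointFree

/-!
# STD₂[12;6]: a class-fixing automorphism with a fixed point is the identity (kernel; the lemma behind the cover tower ZC-2/ZC-3)
Framing: lottery ticket; floor = certified bounds/negative ranges.

Cell pub-namedobj (target M), STD₂[12;6] automorphism census. Designs g5's FAMILY-ZCOVER §1 starts from: 'an automorphism fixing
every point class and every block class and fixing one point fixes the 12 blocks through it, hence every point on them, hence
everything' — so a non-trivial class-fixing automorphism is fixed-point-free (and its quotient is again an STD, the regular-cover
tower). Here is the kernel version in the incidence-array vocabulary of `OrderFiveReduction`, for ANY array automorphism (no order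
hypothesis): if `σ = 1`, `ρ = 1` and some label is fixed (`α i a = a`), then every `α i'` is the identity
(`classFixing_trivial_of_fixed_point`); the one-class step is `all_fixed_of_classFixing` of `OrderThreeFixedPointFree`.
Dually (`dualAut`), a class-fixing automorphism fixing a block is the identity on blocks.
-/

namespace Summit.Ventures.DiscreteObjects.STD

open Finset Equiv Summit.Ventures.DiscreteObjects.PP12

section ClassFixing

variable (π : IncArray 12 6) (τ : ArrayAut π)

/-- **Class-fixing + a fixed point ⟹ identity on points.** For an STD₂[12;6] array automorphism with `σ = 1` and `ρ = 1`, one fixed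
label `α i a = a` forces `α i' = 1` for every point class `i'`. -/
theorem classFixing_trivial_of_fixed_point (hπ : IsSTD 2 π) (hσ1 : ∀ i, τ.σ i = i) (hρ1 : ∀ j, τ.ρ j = j)
    {i : Fin 12} {a : Fin 6} (ha : τ.α i a = a) : ∀ i', τ.α i' = 1 := by
  -- every other class is fixed labelwise
  have hother : ∀ i', i' ≠ i → ∀ b, τ.α i' b = b := fun i' hne b =>
    all_fixed_of_classFixing π τ hπ hσ1 hρ1 ha (Ne.symm hne) b
  -- and then class i itself, seen from a fixed point of another class
  obtain ⟨i₁, hi₁⟩ : ∃ i₁ : Fin 12, i₁ ≠ i := ⟨i + 1, by simp⟩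
  have hself : ∀ b, τ.α i b = b := fun b =>
    all_fixed_of_classFixing π τ hπ hσ1 hρ1 (hother i₁ hi₁ 0) hi₁ b
  intro i'
  by_cases h : i' = i
  · subst h; exact Equiv.ext hself
  · exact Equiv.ext (hother i' h)

/-- The same conclusion packaged as 'non-trivial class-fixing automorphisms are fixed-point-free on points'. -/
theorem classFixing_fixedPointFree (hπ : IsSTD 2 π) (hσ1 : ∀ i, τ.σ i = i) (hρ1 : ∀ j, τ.ρ j = j)
    (hne : ¬ ∀ i, τ.α i = 1) (i : Fin 12) (a : Fin 6) : τ.α i a ≠ a :=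
  fun ha => hne (classFixing_trivial_of_fixed_point π τ hπ hσ1 hρ1 ha)

/-- Dual form: a class-fixing automorphism fixing a block (`β j c = c`) is the identity on blocks. -/
theorem classFixing_trivial_of_fixed_block (hπ : IsSTD 2 π) (hσ1 : ∀ i, τ.σ i = i) (hρ1 : ∀ j, τ.ρ j = j)
    {j : Fin 12} {c : Fin 6} (hc : τ.β j c = c) : ∀ j', τ.β j' = 1 :=
  classFixing_trivial_of_fixed_point (dualArray π) (dualAut π τ) (isSTD_dual π hπ) hρ1 hσ1 hc

end ClassFixing

end Summit.Ventures.DiscreteObjects.STD
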